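import Mathlib
import Literature.Analysis.Calculus.IteratedFDerivSymmetric
import HarnessLib

/-!
# Flat functions are small, and small functions are flat (Taylor estimates at a point)

Elementary Taylor-type estimates at a point for `C^n` maps `f : E → F` between real normed spaces,
stated with Mathlib's `iteratedFDeriv` and WITHOUT Taylor polynomials beyond the single
homogeneous term that is needed:

* `norm_iteratedFDeriv_le_of_flat`, `norm_le_of_iteratedFDeriv_eq_zero` (**flat ⇒ small**): if
  `D^j f(0) = 0` for all `j < m` (and `f` is `C^m` on a ball about `0`), then
  `‖f x‖ ≤ C ‖x‖^m` near `0` — and indeed `‖D^{m-i} f(x)‖ ≤ C‖x‖^i` for `i ≤ m` (induction on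
  `i`, each step the mean value inequality on the segment `[0, x]` applied to `D^{m-i-1} f`, whose
  derivative is `D^{m-i} f` up to a norm-preserving currying);
* `iteratedFDeriv_diagonal_eq_zero` (**scaling**): for a continuous `k`-linear `ψ`, the
  homogeneous polynomial `Q(x) = ψ(x, …, x)` has `D^j Q(0) = 0` for every `j ≠ k`
  (`Q ∘ (2·) = 2^k Q` and the chain rule give `2^j D^jQ(0) = 2^k D^jQ(0)`);
* `iteratedFDeriv_eq_zero_of_norm_le_pow` (**small ⇒ flat at the top order**): if `f` is
  `C^{k+1}` near `0`, `D^j f(0) = 0` for `j < k` and `‖f x‖ ≤ C‖x‖^{k+1}` near `0`, then also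
  `D^k f(0) = 0`. (Subtract `Q(x) = D^k f(0)(x,…,x)/k!`: the difference is flat to order `k`
  — here the symmetry of `D^k f(0)` enters through
  `Literature.Analysis.Calculus.iteratedFDeriv_diag_iteratedFDeriv` — hence `O(‖x‖^{k+1})`,
  so the degree-`k` homogeneous `Q` is `O(‖x‖^{k+1})`, i.e. `Q = 0`, and `k! D^k f(0) = D^k Q = 0`.)

These are the jet-level facts behind "finite order of vanishing ⇒ nontrivial lowest Taylor
term" (used for the holomorphic leading term of solutions of `‖∂̄h‖ ≤ M‖h‖`,
`Literature/Analysis/Complex/DbarInequalityLeadingTerm.lean`). Folklore (H. Cartan, *Calcul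
différentiel* (1967), §5.6, Taylor's formula with the mean value inequality). Everything is proved.
-/

noncomputable section

open scoped Topology ContDiff Nat
open Set Filter Metric Function

namespace Literature.Analysis.Calculus

variable {E F : Type*} [NormedAddCommGroup E] [NormedSpace ℝ E]
  [NormedAddCommGroup F] [NormedSpace ℝ F]

/-! ### Flat implies small -/

/-- **Flat ⇒ small, all intermediate orders.** If `f` is `C^n` on `B(0,r)`, `m ≤ n`, and
`D^j f(0) = 0` for `j < m`, then for some `C ≥ 0`, `0 < ρ ≤ r`:
`‖D^{m-i} f(x)‖ ≤ C ‖x‖^i` for all `i ≤ m` and `x ∈ B(0,ρ)`. [folklore] -/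
theorem norm_iteratedFDeriv_le_of_flat {f : E → F} {r : ℝ} {m : ℕ} {n : WithTop ℕ∞}
    (hf : ContDiffOn ℝ n f (ball (0 : E) r)) (hmn : (m : WithTop ℕ∞) ≤ n) (hr : 0 < r)
    (hflat : ∀ j < m, iteratedFDeriv ℝ j f 0 = 0) :
    ∃ C ρ : ℝ, 0 ≤ C ∧ 0 < ρ ∧ ρ ≤ r ∧ ∀ i ≤ m, ∀ x ∈ ball (0 : E) ρ,
      ‖iteratedFDeriv ℝ (m - i) f x‖ ≤ C * ‖x‖ ^ i := by
  -- `D^m f` is continuous on the ball, hence bounded near `0`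
  have hcont : ContinuousOn (iteratedFDeriv ℝ m f) (ball (0 : E) r) :=
    (hf.continuousOn_iteratedFDerivWithin hmn isOpen_ball.uniqueDiffOn).congr
      fun x hx => (iteratedFDerivWithin_of_isOpen m isOpen_ball hx).symm
  have hcont0 : ContinuousAt (iteratedFDeriv ℝ m f) 0 :=
    hcont.continuousAt (ball_mem_nhds 0 hr)
  obtain ⟨δ, hδ, hδb⟩ := Metric.continuousAt_iff.1 hcont0 1 one_pos
  set C : ℝ := ‖iteratedFDeriv ℝ m f 0‖ + 1 with hC
  have hC0 : 0 ≤ C := by positivity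
  set ρ : ℝ := min δ r with hρ
  have hρ0 : 0 < ρ := lt_min hδ hr
  have hρr : ρ ≤ r := min_le_right _ _
  have hρδ : ρ ≤ δ := min_le_left _ _
  refine ⟨C, ρ, hC0, hρ0, hρr, ?_⟩
  -- differentiability of the intermediate derivatives on the big ball
  have hdiff : ∀ k < m, ∀ y ∈ ball (0 : E) r, DifferentiableAt ℝ (iteratedFDeriv ℝ k f) y := by
    intro k hk y hy
    have hkn : (k : WithTop ℕ∞) < n := lt_of_lt_of_le (by exact_mod_cast hk) hmn
    exact (hf.contDiffAt (isOpen_ball.mem_nhds hy)).differentiableAt_iteratedFDeriv hkn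
  intro i
  induction i with
  | zero =>
    intro _ x hx
    have hx' : dist x 0 < δ := by rw [dist_zero_right]; exact lt_of_lt_of_le (by simpa using hx) hρδ
    have h1 : dist (iteratedFDeriv ℝ m f x) (iteratedFDeriv ℝ m f 0) < 1 := hδb hx'
    rw [dist_eq_norm] at h1
    simp only [Nat.sub_zero, pow_zero, mul_one]
    calc ‖iteratedFDeriv ℝ m f x‖
        = ‖(iteratedFDeriv ℝ m f x - iteratedFDeriv ℝ m f 0) + iteratedFDeriv ℝ m f 0‖ := by
          rw [sub_add_cancel]
      _ ≤ ‖iteratedFDeriv ℝ m f x - iteratedFDeriv ℝ m f 0‖ + ‖iteratedFDeriv ℝ m f 0‖ :=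
          norm_add_le _ _
      _ ≤ C := by rw [hC]; linarith
  | succ i IH =>
    intro hi x hx
    have him : m - i = (m - (i + 1)) + 1 := by omega
    have hk : m - (i + 1) < m := by omega
    have key : ∀ {a b : ℕ}, a = b → ∀ y : E,
        ‖iteratedFDeriv ℝ a f y‖ = ‖iteratedFDeriv ℝ b f y‖ := by
      rintro a b rfl y; rfl
    have IH' : ∀ y ∈ ball (0 : E) ρ, ‖iteratedFDeriv ℝ ((m - (i + 1)) + 1) f y‖ ≤ C * ‖y‖ ^ i := by
      intro y hy; rw [key him.symm y]; exact IH (by omega) y hy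
    set g := iteratedFDeriv ℝ (m - (i + 1)) f with hg
    have hg0 : g 0 = 0 := hflat _ hk
    have hxρ : ‖x‖ < ρ := by simpa using hx
    -- mean value inequality on the closed ball of radius `‖x‖`
    have hsub : closedBall (0 : E) ‖x‖ ⊆ ball (0 : E) ρ := closedBall_subset_ball hxρ
    have hbound : ∀ y ∈ closedBall (0 : E) ‖x‖, ‖fderiv ℝ g y‖ ≤ C * ‖x‖ ^ i := by
      intro y hy
      rw [hg, norm_fderiv_iteratedFDeriv]
      have hy' : ‖y‖ ≤ ‖x‖ := by simpa using hy
      calc ‖iteratedFDeriv ℝ (m - (i + 1) + 1) f y‖ ≤ C * ‖y‖ ^ i := IH' y (hsub hy)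
        _ ≤ C * ‖x‖ ^ i :=
          mul_le_mul_of_nonneg_left (pow_le_pow_left₀ (norm_nonneg _) hy' i) hC0
    have hdg : ∀ y ∈ closedBall (0 : E) ‖x‖, DifferentiableAt ℝ g y :=
      fun y hy => hdiff _ hk y ((ball_subset_ball hρr) (hsub hy))
    have h0mem : (0 : E) ∈ closedBall (0 : E) ‖x‖ := mem_closedBall_self (norm_nonneg x)
    have hxmem : x ∈ closedBall (0 : E) ‖x‖ := mem_closedBall.2 (by simp)
    have hmvt := (convex_closedBall (0 : E) ‖x‖).norm_image_sub_le_of_norm_fderiv_le hdg hbound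
      h0mem hxmem
    rw [hg0, sub_zero, sub_zero] at hmvt
    calc ‖g x‖ ≤ C * ‖x‖ ^ i * ‖x‖ := hmvt
      _ = C * ‖x‖ ^ (i + 1) := by ring

/-- **Flat ⇒ small.** If `f` is `C^n` on `B(0,r)` (`m ≤ n`) and `D^j f(0) = 0` for all `j < m`,
then `‖f x‖ ≤ C ‖x‖^m` on a ball `B(0,ρ)`, `0 < ρ ≤ r`, with `C ≥ 0`. [folklore] -/
theorem norm_le_of_iteratedFDeriv_eq_zero {f : E → F} {r : ℝ} {m : ℕ} {n : WithTop ℕ∞}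
    (hf : ContDiffOn ℝ n f (ball (0 : E) r)) (hmn : (m : WithTop ℕ∞) ≤ n) (hr : 0 < r)
    (hflat : ∀ j < m, iteratedFDeriv ℝ j f 0 = 0) :
    ∃ C ρ : ℝ, 0 ≤ C ∧ 0 < ρ ∧ ρ ≤ r ∧ ∀ x ∈ ball (0 : E) ρ, ‖f x‖ ≤ C * ‖x‖ ^ m := by
  obtain ⟨C, ρ, hC, hρ, hρr, h⟩ := norm_iteratedFDeriv_le_of_flat hf hmn hr hflat
  refine ⟨C, ρ, hC, hρ, hρr, fun x hx => ?_⟩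
  have := h m le_rfl x hx
  rwa [Nat.sub_self, norm_iteratedFDeriv_zero] at this

/-! ### Homogeneous polynomials: derivatives of the wrong order vanish at `0` -/

/-- The diagonal restriction `x ↦ ψ(x,…,x)` of a continuous multilinear map is smooth. [folklore] -/
theorem contDiff_diagonal {k : ℕ} (ψ : ContinuousMultilinearMap ℝ (fun _ : Fin k => E) F)
    {n : WithTop ℕ∞} : ContDiff ℝ n fun x : E => ψ fun _ => x :=
  ψ.contDiff.comp (contDiff_pi.2 fun _ => contDiff_id)

/-- Homogeneity of the diagonal restriction: `ψ(tx,…,tx) = t^k ψ(x,…,x)`. [folklore] -/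
theorem diagonal_smul {k : ℕ} (ψ : ContinuousMultilinearMap ℝ (fun _ : Fin k => E) F)
    (t : ℝ) (x : E) : ψ (fun _ => t • x) = t ^ k • ψ (fun _ => x) := by
  have := ψ.map_smul_univ (fun _ : Fin k => t) (fun _ => x)
  simpa [Finset.prod_const, Finset.card_univ, Fintype.card_fin] using this

/-- **Scaling lemma.** For a continuous `k`-linear map `ψ`, the homogeneous polynomial
`Q(x) = ψ(x,…,x)` satisfies `D^j Q(0) = 0` for every `j ≠ k`. [folklore] -/
theorem iteratedFDeriv_diagonal_eq_zero {k j : ℕ}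
    (ψ : ContinuousMultilinearMap ℝ (fun _ : Fin k => E) F) (hj : j ≠ k) :
    iteratedFDeriv ℝ j (fun x : E => ψ fun _ => x) 0 = 0 := by
  set Q : E → F := fun x => ψ fun _ => x with hQ_def
  have hQ : ContDiff ℝ ∞ Q := contDiff_diagonal ψ
  set L : E →L[ℝ] E := (2 : ℝ) • ContinuousLinearMap.id ℝ E with hL
  have hLx : ∀ x : E, L x = (2 : ℝ) • x := fun x => rfl
  have hcomp : Q ∘ L = fun x => (2 : ℝ) ^ k • Q x := by
    funext x
    simp only [comp_apply, hLx, hQ_def]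
    exact diagonal_smul ψ 2 x
  have h1 : iteratedFDeriv ℝ j (Q ∘ L) 0 =
      (iteratedFDeriv ℝ j Q (L 0)).compContinuousLinearMap fun _ => L :=
    L.iteratedFDeriv_comp_right hQ 0 (by exact_mod_cast le_top)
  have h2 : iteratedFDeriv ℝ j (fun x => (2 : ℝ) ^ k • Q x) 0 = (2 : ℝ) ^ k • iteratedFDeriv ℝ j Q 0 :=
    iteratedFDeriv_const_smul_apply' (hQ.contDiffAt.of_le (by exact_mod_cast le_top))
  rw [hcomp, h2, map_zero] at h1
  ext v
  have h3 := congrArg (fun T : ContinuousMultilinearMap ℝ (fun _ : Fin j => E) F => T v) h1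
  simp only [smul_apply, ContinuousMultilinearMap.compContinuousLinearMap_apply, hLx] at h3
  rw [(iteratedFDeriv ℝ j Q 0).map_smul_univ (fun _ : Fin j => (2 : ℝ)) v] at h3
  simp only [Finset.prod_const, Finset.card_univ, Fintype.card_fin] at h3
  -- `2^k • D v = 2^j • D v` with `2^j ≠ 2^k`
  have hne : (2 : ℝ) ^ k - 2 ^ j ≠ 0 := by
    intro h
    have h' : (2 : ℝ) ^ k = 2 ^ j := sub_eq_zero.1 h
    exact hj ((pow_right_injective₀ (by norm_num : (0 : ℝ) < 2) (by norm_num)) h').symm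
  have h4 : ((2 : ℝ) ^ k - 2 ^ j) • iteratedFDeriv ℝ j Q 0 v = 0 := by
    rw [sub_smul, h3, sub_self]
  simpa [hne] using h4

/-! ### Small implies flat at the top order -/

/-- **Small ⇒ flat (top order).** Let `f` be `C^n` on `B(0,r)` with `k + 1 ≤ n`, `D^j f(0) = 0`
for `j < k`, and `‖f x‖ ≤ C‖x‖^{k+1}` on `B(0,r)`. Then `D^k f(0) = 0`. [folklore] -/
theorem iteratedFDeriv_eq_zero_of_norm_le_pow {f : E → F} {r C : ℝ} {k : ℕ} {n : WithTop ℕ∞}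
    (hf : ContDiffOn ℝ n f (ball (0 : E) r)) (hkn : ((k + 1 : ℕ) : WithTop ℕ∞) ≤ n)
    (hr : 0 < r) (hlow : ∀ j < k, iteratedFDeriv ℝ j f 0 = 0)
    (hsmall : ∀ x ∈ ball (0 : E) r, ‖f x‖ ≤ C * ‖x‖ ^ (k + 1)) :
    iteratedFDeriv ℝ k f 0 = 0 := by
  have hkn' : (k : WithTop ℕ∞) ≤ n := le_trans (by exact_mod_cast k.le_succ) hkn
  have hf0 : ContDiffAt ℝ n f 0 := hf.contDiffAt (ball_mem_nhds 0 hr)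
  set ψ := iteratedFDeriv ℝ k f 0 with hψ
  set c : ℝ := ((k ! : ℕ) : ℝ)⁻¹ with hc
  set Q : E → F := fun x => c • ψ (fun _ => x) with hQ_def
  have hdiag : ContDiff ℝ n fun x : E => ψ fun _ => x := contDiff_diagonal ψ
  have hQ : ContDiff ℝ n Q := contDiff_const.smul hdiag
  -- the `k`-jet of `Q` at `0` is that of `f`
  have hQlow : ∀ j < k, iteratedFDeriv ℝ j Q 0 = 0 := by
    intro j hj
    have hjn : (j : WithTop ℕ∞) ≤ n := le_trans (by exact_mod_cast hj.le) hkn'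
    rw [hQ_def, iteratedFDeriv_const_smul_apply' (hdiag.contDiffAt.of_le hjn),
      iteratedFDeriv_diagonal_eq_zero ψ hj.ne, smul_zero]
  have hQtop : iteratedFDeriv ℝ k Q 0 = ψ := by
    rw [hQ_def, iteratedFDeriv_const_smul_apply' (hdiag.contDiffAt.of_le hkn'), hψ,
      iteratedFDeriv_diag_iteratedFDeriv hf0 hkn' (0 : E), smul_smul, hc,
      inv_mul_cancel₀ (by exact_mod_cast (Nat.factorial_ne_zero k)), one_smul]
  -- the remainder `f - Q` is flat to order `k`, hence `O(‖x‖^{k+1})`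
  set R' : E → F := fun x => f x - Q x with hR'
  have hR'diff : ContDiffOn ℝ n R' (ball (0 : E) r) := hf.sub hQ.contDiffOn
  have hR'flat : ∀ j < k + 1, iteratedFDeriv ℝ j R' 0 = 0 := by
    intro j hj
    have hjn : (j : WithTop ℕ∞) ≤ n := le_trans (by exact_mod_cast Nat.lt_succ_iff.mp hj) hkn'
    have hsub : iteratedFDeriv ℝ j R' 0 = iteratedFDeriv ℝ j f 0 - iteratedFDeriv ℝ j Q 0 := by
      rw [hR', show (fun x => f x - Q x) = f - Q from rfl]
      exact iteratedFDeriv_sub_apply (hf0.of_le hjn) (hQ.contDiffAt.of_le hjn)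
    rw [hsub]
    rcases Nat.lt_succ_iff_lt_or_eq.mp hj with hj' | rfl
    · rw [hlow j hj', hQlow j hj', sub_zero]
    · rw [hQtop, hψ, sub_self]
  obtain ⟨C', ρ, hC', hρ, hρr, hR'b⟩ :=
    norm_le_of_iteratedFDeriv_eq_zero hR'diff hkn hr hR'flat
  -- hence the homogeneous `Q` is `O(‖x‖^{k+1})` near `0`
  have hQb : ∀ x ∈ ball (0 : E) ρ, ‖Q x‖ ≤ (C + C') * ‖x‖ ^ (k + 1) := by
    intro x hx
    have h1 := hsmall x (ball_subset_ball hρr hx)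
    have h2 := hR'b x hx
    calc ‖Q x‖ = ‖f x - R' x‖ := by rw [hR']; simp
      _ ≤ ‖f x‖ + ‖R' x‖ := norm_sub_le _ _
      _ ≤ (C + C') * ‖x‖ ^ (k + 1) := by linarith
  -- and therefore vanishes identically
  have hQzero : ∀ x : E, Q x = 0 := by
    intro x
    have hhom : ∀ t : ℝ, Q (t • x) = t ^ k • Q x := by
      intro t; rw [hQ_def]; simp only; rw [diagonal_smul, smul_comm]
    -- for small `t > 0`: `‖Q x‖ ≤ (C + C') t ‖x‖^{k+1}`
    have hev : ∀ᶠ t in 𝓝[>] (0 : ℝ), ‖Q x‖ ≤ (C + C') * ‖x‖ ^ (k + 1) * t := by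
      have hδ : 0 < ρ / (‖x‖ + 1) := by positivity
      filter_upwards [Ioo_mem_nhdsGT hδ] with t ht
      have ht0 : 0 < t := ht.1
      have htx : t • x ∈ ball (0 : E) ρ := by
        rw [mem_ball, dist_zero_right, norm_smul, Real.norm_eq_abs, abs_of_pos ht0]
        have : t * (‖x‖ + 1) < ρ := (lt_div_iff₀ (by positivity)).1 ht.2
        nlinarith [norm_nonneg x]
      have hb := hQb (t • x) htx
      have hn1 : ‖Q (t • x)‖ = t ^ k * ‖Q x‖ := by
        rw [hhom, norm_smul, norm_pow, Real.norm_eq_abs, abs_of_pos ht0]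
      have hn2 : ‖t • x‖ = t * ‖x‖ := by
        rw [norm_smul, Real.norm_eq_abs, abs_of_pos ht0]
      rw [hn1, hn2, mul_pow] at hb
      -- `t^k ‖Q x‖ ≤ (C+C') t^{k+1} ‖x‖^{k+1}`
      have htk : 0 < t ^ k := pow_pos ht0 k
      have : t ^ k * ‖Q x‖ ≤ t ^ k * ((C + C') * ‖x‖ ^ (k + 1) * t) := by
        calc t ^ k * ‖Q x‖ ≤ (C + C') * (t ^ (k + 1) * ‖x‖ ^ (k + 1)) := hb
          _ = t ^ k * ((C + C') * ‖x‖ ^ (k + 1) * t) := by ring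
      exact le_of_mul_le_mul_left this htk
    have htend : Tendsto (fun t : ℝ => (C + C') * ‖x‖ ^ (k + 1) * t) (𝓝[>] (0 : ℝ)) (𝓝 0) := by
      have : Tendsto (fun t : ℝ => (C + C') * ‖x‖ ^ (k + 1) * t) (𝓝 (0 : ℝ)) (𝓝 _) :=
        (continuous_const.mul continuous_id).tendsto 0
      simpa using this.mono_left nhdsWithin_le_nhds
    have hle : ‖Q x‖ ≤ 0 := ge_of_tendsto htend hev
    exact norm_le_zero_iff.1 hle
  -- `k! • ψ = D^k (ψ ∘ diag) (0) = D^k (c⁻¹ Q)(0) = 0`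
  have hdiag0 : (fun x : E => ψ fun _ => x) = fun _ => (0 : F) := by
    funext x
    have hx := hQzero x
    rw [hQ_def] at hx
    have hc0 : c ≠ 0 := inv_ne_zero (by exact_mod_cast Nat.factorial_ne_zero k)
    simpa [hc0] using hx
  have hkψ : ((k ! : ℕ) : ℝ) • ψ = 0 := by
    rw [hψ, ← iteratedFDeriv_diag_iteratedFDeriv hf0 hkn' (0 : E), ← hψ, hdiag0]
    simp
  exact (smul_eq_zero.1 hkψ).resolve_left (by exact_mod_cast Nat.factorial_ne_zero k)

end Literature.Analysis.Calculus

end
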